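import Summits.Ventures.PercRepro.RankLevelSetHallRuleL

/-!
# PercRepro — THE FLAT-LYM KERNEL («LYM over closure flats») AT THE TIGHT LAYER: LOADS ≤ 1, AND THE TRANSFER TO THE UP-HALL
FORM (p4, gen 38; paper proofs/P4-KERNEL-A-DEAD.md §4; C-044, UP form, tight layer `#E = p + q`, any `k = p − q ≥ 2`)

The flat-share kernel A of RankLevelSetHallFlatShare (`FlatShareRecv`, the former `k ≥ 3` conjecture of record) is FALSE at
`k = 3` for `q ≥ 41` (proofs/P4-KERNEL-A-DEAD.md).  The replacement candidate of record is the **flat-LYM kernel**: for a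
`Y`-set `S` let `Flats(S)` be the closures of the members inside `S` (`memberFlats`) and
`Λ(S) := Σ_{G ∈ Flats(S)} C(#(S ∩ G), q)` (`lymFlatSum`); every member `Z ⊆ S` receives `1 / Λ(S)` from `S`
(`flWeight`) — on EVERY `Y`-set, middle levels and big sets alike.  THIS FILE: the weight is non-negative, supported on
`Z ⊆ S`, and **every `Y`-set is loaded at most `1`** (`flWeight_load_le_one`): the members inside `S` with closure `G` are
`q`-subsets of `S ∩ G`, at most `C(#(S ∩ G), q)` of them (`ncard_members_subset_le_choose` at the tight layer), so the members
inside `S` number at most `Λ(S)`.  `FlatLymRecv M p q` (a `Prop`, NOT asserted: every member receives at least `Φ(p,q)`)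
therefore gives the UP-Hall condition for every family (`hallUp_of_ncard_eq_of_flatLym`).  Census (p4 g38, own exact code):
min receipt/Φ = 1 on 25 random vector matroids (`n ≤ 12`, `k ≤ 5`; equality at the members without lost sets) and ≥ 1.30 on
21 structured instances including the family that kills kernel A; adversarial climbs kit j335187.  It is NOT proved.

* `memberFlats`, `lymFlatSum`, `flWeight`;
* `memberFlats_finite`, `flWeight_nonneg`, `subset_of_flWeight_ne_zero`, `lymFlatSum_pos`;
* **`flWeight_load_le_one`** — `#E = p + q` ⇒ every `Y`-set is loaded at most `1`;
* `FlatLymRecv`, **`hallUp_of_ncard_eq_of_flatLym`**.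
Axioms: standard.
-/

namespace PercRepro

open Set Matroid Finset

variable {α : Type} (M : Matroid α) [M.Finite]

/-- The closure flats of the members inside `S`. -/
def memberFlats (p q : ℕ) (S : Set α) : Set (Set α) := {G | ∃ Z ∈ cellMembers M p q, Z ⊆ S ∧ M.closure Z = G}

/-- The member flats of `S` are finitely many (closures of members). -/
theorem memberFlats_finite (p q : ℕ) (S : Set α) : (memberFlats M p q S).Finite := by
  refine ((cellMembers_finite M p q).image M.closure).subset ?_
  rintro G ⟨Z, hZ, -, rfl⟩
  exact ⟨Z, hZ, rfl⟩

/-- `Λ(S) = Σ_{G ∈ Flats(S)} C(#(S ∩ G), q)`. -/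
noncomputable def lymFlatSum (p q : ℕ) (S : Set α) : ℚ :=
  ∑ G ∈ (memberFlats_finite M p q S).toFinset, (((S ∩ G).ncard.choose q : ℕ) : ℚ)

/-- **The flat-LYM weight** of the member `Z` at the `Y`-set `S`: `1 / Λ(S)` when `Z ⊆ S`, `0` otherwise. -/
noncomputable def flWeight (p q : ℕ) (Z S : Set α) : ℚ := by
  classical
  exact if Z ∈ cellMembers M p q ∧ Z ⊆ S ∧ S ∈ cellY M p q then 1 / lymFlatSum M p q S else 0

/-- `Λ(S) ≥ 0`. -/
theorem lymFlatSum_nonneg (p q : ℕ) (S : Set α) : 0 ≤ lymFlatSum M p q S := by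
  unfold lymFlatSum
  exact Finset.sum_nonneg (fun G _ => by positivity)

/-- The weight is non-negative. -/
theorem flWeight_nonneg (p q : ℕ) (Z S : Set α) : 0 ≤ flWeight M p q Z S := by
  classical
  unfold flWeight
  split_ifs
  · exact div_nonneg zero_le_one (lymFlatSum_nonneg M p q S)
  · exact le_rfl

/-- The weight is supported on the pairs `Z ⊆ S`. -/
theorem subset_of_flWeight_ne_zero (p q : ℕ) (Z S : Set α) (h : flWeight M p q Z S ≠ 0) : Z ⊆ S := by
  classical
  by_contra hZS
  apply h
  unfold flWeight
  rw [if_neg (fun hc => hZS hc.2.1)]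

/-- A set with a member inside has `Λ(S) ≥ 1` (the member's own flat contributes `C(#(S ∩ cl Z), q) ≥ 1`). -/
theorem lymFlatSum_pos (p q : ℕ) (hE : M.E.ncard = p + q) {Z S : Set α} (hZ : Z ∈ cellMembers M p q) (hZS : Z ⊆ S)
    (hS : S ⊆ M.E) : 1 ≤ lymFlatSum M p q S := by
  classical
  unfold lymFlatSum
  have hmem : M.closure Z ∈ (memberFlats_finite M p q S).toFinset := by
    rw [(memberFlats_finite M p q S).mem_toFinset]
    exact ⟨Z, hZ, hZS, rfl⟩
  have hterm : (1 : ℚ) ≤ (((S ∩ M.closure Z).ncard.choose q : ℕ) : ℚ) := by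
    have hsub : Z ⊆ S ∩ M.closure Z := Set.subset_inter hZS (M.subset_closure Z hZ.1)
    have hq : q ≤ (S ∩ M.closure Z).ncard := by
      rw [← ncard_eq_q_of_mem_cellMembers_tight M hE hZ]
      exact Set.ncard_le_ncard hsub ((M.set_finite S hS).subset inter_subset_left)
    have := Nat.choose_pos hq
    exact_mod_cast this
  calc (1 : ℚ) ≤ (((S ∩ M.closure Z).ncard.choose q : ℕ) : ℚ) := hterm
    _ ≤ ∑ G ∈ (memberFlats_finite M p q S).toFinset, (((S ∩ G).ncard.choose q : ℕ) : ℚ) :=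
        Finset.single_le_sum (f := fun G => (((S ∩ G).ncard.choose q : ℕ) : ℚ)) (fun G _ => by positivity) hmem

/-- **Every `Y`-set is loaded at most `1`** at the tight layer: the members inside `S` are partitioned by their closure flat
`G ∈ Flats(S)`, the class of `G` being `q`-subsets of `S ∩ G`, hence of size at most `C(#(S ∩ G), q)`; so the members inside `S`
number at most `Λ(S)`. -/
theorem flWeight_load_le_one (p q : ℕ) (hE : M.E.ncard = p + q) {S : Set α} (hS : S ∈ cellY M p q) :
    ∑ Z ∈ (cellMembers_finite M p q).toFinset, flWeight M p q Z S ≤ 1 := by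
  classical
  set Mf : Finset (Set α) := (cellMembers_finite M p q).toFinset with hMf
  have hmemM : ∀ Z, Z ∈ Mf ↔ Z ∈ cellMembers M p q := fun Z => by
    rw [hMf, (cellMembers_finite M p q).mem_toFinset]
  set Ff : Finset (Set α) := (memberFlats_finite M p q S).toFinset with hFf
  have hmemF : ∀ G, G ∈ Ff ↔ G ∈ memberFlats M p q S := fun G => by
    rw [hFf, (memberFlats_finite M p q S).mem_toFinset]
  -- the weight of `Z` is `1/Λ(S)` on the members inside `S`
  have hw : ∀ Z ∈ Mf, flWeight M p q Z S = if Z ⊆ S then 1 / lymFlatSum M p q S else 0 := by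
    intro Z hZ
    rw [hmemM] at hZ
    unfold flWeight
    by_cases hZS : Z ⊆ S
    · rw [if_pos ⟨hZ, hZS, hS⟩, if_pos hZS]
    · rw [if_neg (fun hc => hZS hc.2.1), if_neg hZS]
  rw [Finset.sum_congr rfl hw, Finset.sum_ite, Finset.sum_const_zero, add_zero, Finset.sum_const, nsmul_eq_mul]
  -- the members inside `S`, counted through their closure flats
  set Af : Finset (Set α) := Mf.filter (fun Z => Z ⊆ S) with hAf
  by_cases hA : Af = ∅
  · rw [hA, Finset.card_empty]
    simp
  · obtain ⟨Z₀, hZ₀⟩ := Finset.nonempty_iff_ne_empty.2 hA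
    rw [hAf, Finset.mem_filter, hmemM] at hZ₀
    have hΛ : 1 ≤ lymFlatSum M p q S := lymFlatSum_pos M p q hE hZ₀.1 hZ₀.2 hS.1
    have hcount : (Af.card : ℚ) ≤ lymFlatSum M p q S := by
      -- Af.card = Σ_{G ∈ Ff} #{Z ∈ Af : cl Z = G}
      have hsplit : Af.card = ∑ G ∈ Ff, (Af.filter (fun Z => M.closure Z = G)).card := by
        rw [← Finset.card_biUnion]
        · congr 1
          ext Z
          rw [Finset.mem_biUnion]
          constructor
          · intro hZ
            refine ⟨M.closure Z, ?_, Finset.mem_filter.2 ⟨hZ, rfl⟩⟩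
            rw [hmemF]
            rw [hAf, Finset.mem_filter, hmemM] at hZ
            exact ⟨Z, hZ.1, hZ.2, rfl⟩
          · rintro ⟨G, -, hZ⟩
            exact (Finset.mem_filter.1 hZ).1
        · intro G _ G' _ hne
          rw [Function.onFun, Finset.disjoint_left]
          intro Z hZ hZ'
          rw [Finset.mem_filter] at hZ hZ'
          exact hne (hZ.2.symm.trans hZ'.2)
      have hclass : ∀ G ∈ Ff, ((Af.filter (fun Z => M.closure Z = G)).card : ℚ)
          ≤ (((S ∩ G).ncard.choose q : ℕ) : ℚ) := by
        intro G _
        have h := ncard_members_subset_le_choose M hE (S := S ∩ G) (inter_subset_left.trans hS.1)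
        have hsub : ((Af.filter (fun Z => M.closure Z = G) : Finset (Set α)) : Set (Set α))
            ⊆ {Z : Set α | Z ∈ cellMembers M p q ∧ Z ⊆ S ∩ G} := by
          intro Z hZ
          rw [Finset.mem_coe, Finset.mem_filter, hAf, Finset.mem_filter, hmemM] at hZ
          refine ⟨hZ.1.1, Set.subset_inter hZ.1.2 ?_⟩
          rw [← hZ.2]
          exact M.subset_closure Z hZ.1.1.1
        have hfin : {Z : Set α | Z ∈ cellMembers M p q ∧ Z ⊆ S ∩ G}.Finite :=
          (cellMembers_finite M p q).subset (fun Z hZ => hZ.1)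
        have h2 := Set.ncard_le_ncard hsub hfin
        rw [ncard_coe_finset] at h2
        exact_mod_cast h2.trans h
      unfold lymFlatSum
      rw [hsplit]
      push_cast
      exact Finset.sum_le_sum hclass
    rw [mul_one_div, div_le_one (by linarith)]
    exact hcount

/-- **The flat-LYM receipt condition** (a `Prop`, NOT asserted): every member receives at least `Φ(p,q)` under the flat-LYM
kernel.  The candidate of record for `k ≥ 3` (numerically: min receipt/Φ = 1 on the random census, ≥ 1.30 on the structured
instances incl. the family that refutes kernel A). -/
def FlatLymRecv (p q : ℕ) : Prop :=
  ∀ Z ∈ cellMembers M p q, phiK p q ≤ ∑ S ∈ (cellY_finite M p q).toFinset, flWeight M p q Z S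

/-- **THE TRANSFER**: at the tight layer `#E = p + q`, `FlatLymRecv M p q` gives the UP-Hall condition for every family of
members (through night-1's `hallUp_of_fracMatching`). -/
theorem hallUp_of_ncard_eq_of_flatLym (p q : ℕ) (hE : M.E.ncard = p + q) (h : FlatLymRecv M p q)
    (𝒜 : Set (Set α)) (h𝒜 : 𝒜 ⊆ cellMembers M p q) :
    phiK p q * (𝒜.ncard : ℚ) ≤ ((upNbhd M p q 𝒜).ncard : ℚ) :=
  hallUp_of_fracMatching M p q (flWeight M p q) (flWeight_nonneg M p q) (subset_of_flWeight_ne_zero M p q)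
    (fun _ hZ => h _ hZ) (fun _ hS => flWeight_load_le_one M p q hE hS) 𝒜 h𝒜

end PercRepro
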